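import Summits.BirchSwinnertonDyer.BirchSwinnertonDyer.Theorems.GenusKolyvaginAtTwoGenusPrimitiveSupplyAtTwoTwistNormForm
import Summits.BirchSwinnertonDyer.BirchSwinnertonDyer.Theorems.GenusKolyvaginAtTwoGenusPrimitiveSupplyAtTwoPrimeTwistInertRat
import Literature.NumberTheory.EllipticCurves.Kramer1981.RamifiedOddGoodNormIndexProofs
import Summits.BirchSwinnertonDyer.BirchSwinnertonDyer.Theorems.GenusKolyvaginAtTwoGenusPrimitiveSupplyAtTwoTwoTranspositionOfDictionary
import Summits.BirchSwinnertonDyer.BirchSwinnertonDyer.Theorems.GenusKolyvaginAtTwoGenusPrimitiveSupplyAtTwoTwistCondAboveKernel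
import Literature.NumberTheory.EllipticCurves.CasselsTateSelmerKolyvaginValue
import HarnessLib

/-!
# Route `GenusKolyvaginAtTwo`, crux #2 `GenusPrimitiveSupplyAtTwo` (stmt-BirchSwinnertonDyer-22136):
# KRAMER'S RAMIFIED NORM STEP — at an odd place of good reduction RAMIFIED in `K(√d)`, a `χ`-norm `S + τS` is a DOUBLE `P + P`
# of a rational point; hence the twisted and the untwisted `2`-Selmer local conditions meet only in `0`

Width seat `bsd-line-gk2-p4` g15 (cell `bsd-f1-sign2`), step (b′) of the plan in `Lines/genus-supply-transposition-door-g14.md` §6, sequel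
of `…TwistNormForm` (step (a′), p672791). THEOREMS ONLY; helper `--supports stmt-BirchSwinnertonDyer-22136`; no item is closed; BSD is not
proved by any of this.

WHAT.
* §33 `exists_norm_eq_baseChange_add_self_of_hasGoodReductionAt` — `W/K` over a number field, `v` a finite place of GOOD reduction with ODD
  residue characteristic, `K' ⊆ K̄_v` a RAMIFIED quadratic extension of `K_v` (`K' = K_v(x)`, `x² = d ∉ K_v²`, `K' ⊄ K_v^{nr}`), `σ ≠ 1`:
  every norm `S₁ + σS₁` from `W(K')` is `ι(P₁ + P₁)` with `P₁ ∈ W(K_v)` — Kramer 1981 Prop. 3's proof («`N E(K) = 2E(F)`», tree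
  `Kramer1981.normSubgroup_eq_map_range_two_ramified` for a unit-discriminant `𝒪_v`-model), transported to `W ⊗ K_v` along the
  `σ`-equivariant substitution `VariableChange.pointEquivBaseChange` (Silverman III.3.1 (b)) and its functoriality in the field.
* §34 `exists_fixed_add_self_eq_norm_of_forall_exists` (any perfect `F`, any `V/F`, any `K' ⊆ F̄`, Galois descent) and
  **`exists_fixed_add_self_eq_norm_of_not_mem_maxUnramified`** — the series' currency (`localPoints W K_v`, `α = ι√d ∉ K_v^{nr}`, `τ₀` flipping
  `α`): every `S ∈ W(K̄_v)` fixed by the stabiliser of `α` has `S + τ₀S = P + P` with `P` fixed by `Γ_{K_v}`.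
* §35 **`res_eq_zero_of_mem_primeTwist_selmerLocalKer_of_mem_selmerLocalKer_of_ramified`** — Mazur–Rubin 2010 Lemma 2.11 / 2007 Prop. 5.2
  in PRIME-TWIST currency at `p = 2`: at such a place, a class of `H¹(K, E[2])` lying in BOTH the twisted condition `PrimeTwist.selmerLocalKer W χ K_v`
  (`χ|_{Γ_v}` the character of `K_v(α)`) AND `W`'s own Kummer condition `W.selmerLocalKer K_v 2` VANISHES in `H¹(K_v, E[2])`: by step (a′) its
  Kummer point `Q` has `2Q = S + τ₀S`, by (b′) `= P + P` with `P ∈ E(K_v)`, so `κ(Q) = κ(P) = 0`.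

Honest framing: KNOWN in print (Kramer 1981 Prop. 3; Mazur–Rubin 2007 Prop. 5.2 / 2010 Lemma 2.11: `H¹_f ∩ H¹_f^{(d)} = E_N(K_v)/2E(K_v) = 0`
at a ramified odd good place); kernel-new plumbing; beyond-print theorem: no. Crux 22136 stays OPEN at (U) 24947 ∧ (CONV₂) 19220/24948.

References: [Kramer1981] §2 Prop. 3 (p. 125) and its proof; [MazurRubin2010] Lemmas 2.9, 2.11; [MazurRubin2007] Def 4.3, Prop 5.2, §5;
[SilvermanAEC2009] III.3.1 (b), VIII.§1–§2.
-/

set_option linter.dupNamespace false -- tree convention: `Summit.BirchSwinnertonDyer.BirchSwinnertonDyer.Theorems` (summit = sub-problem)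
set_option autoImplicit false

noncomputable section

open scoped Classical ValuativeRel

namespace Summit.BirchSwinnertonDyer.BirchSwinnertonDyer.Theorems.GenusKolyTransp

open WeierstrassCurve Field NumberField IsDedekindDomain Function
open Literature.NumberTheory.EllipticCurves Literature.NumberTheory.GaloisRepresentations
open Literature.NumberTheory.GaloisRepresentations.IsNonarchimedeanLocalField (maxUnramified)
open Literature.NumberTheory.EllipticCurves.KramerTunnell1982 (normSubgroup fixedSubgroup mem_normSubgroup_iff)
open Literature.NumberTheory.GaloisCohomology
open Summit.BirchSwinnertonDyer.BirchSwinnertonDyer.Theorems.GenusKolyArch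

universe u

/-! ## §33 Kramer's `N E(K') = ι(2 E(K_v))` transported to `W ⊗ K_v` -/

section KPoints

variable {K : Type} [Field K] [NumberField K] (W : WeierstrassCurve K) (v : HeightOneSpectrum (𝓞 K))

/-- **Kramer 1981 Prop. 3 («`N E(K) = 2E(F)`») in the point currency of `W ⊗ K_v`.** `W/K` with good reduction at `v`, `v` of odd residue
characteristic, `K' = K_v(x) ⊆ K̄_v` a RAMIFIED quadratic extension (`x² = d ∉ K_v²`, `K' ⊄ K_v^{nr}`), `σ ≠ 1` in `Aut(K'/K_v)`: every norm
`S₁ + σS₁` of a `K'`-point is the base change of a DOUBLE `P₁ + P₁` of a `K_v`-point. The unit-discriminant `𝒪_v`-model `M` of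
`exists_integer_model_of_hasGoodReductionAt` has `N M(K') = ι(2 M(K_v))` (`Kramer1981.normSubgroup_eq_map_range_two_ramified`), and the
`σ`-equivariant substitution `VariableChange.pointEquivBaseChange` (`M ⊗ K_v = C • (W ⊗ K_v)`), functorial in the field
(`pointEquivBaseChange_map`), carries the statement over. [cite: Kramer1981, §2 proof of Prop. 3 (p. 125)] [cite: SilvermanAEC2009, III.3.1(b)] -/
theorem exists_norm_eq_baseChange_add_self_of_hasGoodReductionAt (hv : W.HasGoodReductionAt v)
    (hodd : ringChar 𝓀[v.adicCompletion K] ≠ 2)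
    {K' : IntermediateField (v.adicCompletion K) (AlgebraicClosure (v.adicCompletion K))}
    (h2 : Module.finrank (v.adicCompletion K) K' = 2) (hram : ¬ K' ≤ maxUnramified (v.adicCompletion K))
    {d : v.adicCompletion K} (hd : ¬ IsSquare d) {x : K'} (hx : x ^ 2 = algebraMap (v.adicCompletion K) K' d)
    {σ : K' ≃ₐ[v.adicCompletion K] K'} (hσ : σ ≠ 1)
    (S₁ : ((W.baseChange (v.adicCompletion K)).baseChange K').toAffine.Point) :
    ∃ P₁ : ((W.baseChange (v.adicCompletion K)).baseChange (v.adicCompletion K)).toAffine.Point,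
      S₁ + Affine.Point.map (W' := W.baseChange (v.adicCompletion K)) (σ : K' →ₐ[v.adicCompletion K] K') S₁ =
        Affine.Point.baseChange (W' := W.baseChange (v.adicCompletion K)) (v.adicCompletion K) K' P₁ +
          Affine.Point.baseChange (W' := W.baseChange (v.adicCompletion K)) (v.adicCompletion K) K' P₁ := by
  haveI : CharZero (v.adicCompletion K) := charZero_of_injective_algebraMap (algebraMap K _).injective
  obtain ⟨M, C, hΔ, hM⟩ := exists_integer_model_of_hasGoodReductionAt W v hv
  -- Kramer on the unit-discriminant model `M ⊗ K_v = C • (W ⊗ K_v)`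
  have hK := Kramer1981.normSubgroup_eq_map_range_two_ramified hodd M hΔ h2 hram hd hx hσ
  rw [hM] at hK
  have hmem : VariableChange.pointEquivBaseChange (W.baseChange (v.adicCompletion K)) C K'
      (S₁ + Affine.Point.map (W' := W.baseChange (v.adicCompletion K)) (σ : K' →ₐ[v.adicCompletion K] K') S₁) ∈
      normSubgroup (C • W.baseChange (v.adicCompletion K)) K' σ :=
    mem_normSubgroup_iff.mpr ⟨VariableChange.pointEquivBaseChange (W.baseChange (v.adicCompletion K)) C K' S₁, by
      rw [map_add, VariableChange.pointEquivBaseChange_map_algEquiv]⟩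
  rw [hK] at hmem
  obtain ⟨_, ⟨P₀, rfl⟩, hP₀⟩ := AddSubgroup.mem_map.mp hmem
  refine ⟨(VariableChange.pointEquivBaseChange (W.baseChange (v.adicCompletion K)) C (v.adicCompletion K)).symm P₀,
    (VariableChange.pointEquivBaseChange (W.baseChange (v.adicCompletion K)) C K').injective ?_⟩
  rw [← hP₀, nsmulAddMonoidHom_apply, two_nsmul, map_add, map_add]
  change Affine.Point.map (W' := C • W.baseChange (v.adicCompletion K)) (Algebra.ofId (v.adicCompletion K) K') P₀ +
      Affine.Point.map (W' := C • W.baseChange (v.adicCompletion K)) (Algebra.ofId (v.adicCompletion K) K') P₀ =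
    VariableChange.pointEquivBaseChange (W.baseChange (v.adicCompletion K)) C K'
        (Affine.Point.map (W' := W.baseChange (v.adicCompletion K)) (Algebra.ofId (v.adicCompletion K) K') _) +
      VariableChange.pointEquivBaseChange (W.baseChange (v.adicCompletion K)) C K'
        (Affine.Point.map (W' := W.baseChange (v.adicCompletion K)) (Algebra.ofId (v.adicCompletion K) K') _)
  rw [← VariableChange.pointEquivBaseChange_map, AddEquiv.apply_symm_apply]

end KPoints

/-! ## §34 Galois descent: from `K'`-points to geometric points, and the series' currency -/

section Descent

variable {F : Type u} [Field F] (V : WeierstrassCurve F) (K' : IntermediateField F (AlgebraicClosure F))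

/-- **From «norms are doubles» on `K'`-points to geometric points.** `F` perfect, `K' ⊆ F̄` with an `F`-automorphism `σ`, `τ₀ ∈ Γ_F`
restricting to `σ` on `K'`. If every norm `S₁ + σS₁` of a `K'`-point is `ι(P₁ + P₁)` with `P₁ ∈ V(F)`, then every geometric point `S` fixed
by `Gal(F̄/K')` has `S + τ₀S = P + P` with `P` fixed by `Γ_F`: descend `S` to `S₁ ∈ V(K')` (Silverman VIII.§1), and push `P₁` to `F̄`.
[cite: SilvermanAEC2009, VIII.§1] [cite: Kramer1981, §2 proof of Prop. 3 (p. 125)] -/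
theorem exists_fixed_add_self_eq_norm_of_forall_exists [PerfectField F] (σ : K' ≃ₐ[F] K')
    (hN : ∀ S₁ : (V.baseChange K').toAffine.Point, ∃ P₁ : (V.baseChange F).toAffine.Point,
      S₁ + Affine.Point.map (W' := V) (σ : K' →ₐ[F] K') S₁ =
        Affine.Point.baseChange (W' := V) F K' P₁ + Affine.Point.baseChange (W' := V) F K' P₁)
    {τ₀ : absoluteGaloisGroup F}
    (hτ₀ : ∀ x : K', (show AlgebraicClosure F ≃ₐ[F] AlgebraicClosure F from τ₀) (x : AlgebraicClosure F) =
      ((σ x : K') : AlgebraicClosure F))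
    {S : geomPoints V}
    (hS : ∀ g : absoluteGaloisGroup F,
      (∀ x : K', (show AlgebraicClosure F ≃ₐ[F] AlgebraicClosure F from g) (x : AlgebraicClosure F) = x) → g • S = S) :
    ∃ P ∈ MulAction.fixedPoints (absoluteGaloisGroup F) (geomPoints V), S + τ₀ • S = P + P := by
  obtain ⟨S₁, rfl⟩ := exists_map_val_eq_of_forall_smul_eq V K' hS
  obtain ⟨P₁, hP₁⟩ := hN S₁
  refine ⟨toGeomPoints V P₁, fun g ↦ smul_toGeomPoints V g P₁, ?_⟩
  change Affine.Point.map (W' := V) (IntermediateField.val K') S₁ +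
      Affine.Point.map (W' := V)
        ((show AlgebraicClosure F ≃ₐ[F] AlgebraicClosure F from τ₀) : AlgebraicClosure F →ₐ[F] AlgebraicClosure F)
        (Affine.Point.map (W' := V) (IntermediateField.val K') S₁) = toGeomPoints V P₁ + toGeomPoints V P₁
  rw [smul_map_val_eq_of_forall_apply V K' τ₀ σ hτ₀ S₁, ← map_add, hP₁, map_add, map_val_baseChange_eq_toGeomPoints]
  rfl

end Descent

section Local

variable {K : Type} [Field K] [NumberField K] (W : WeierstrassCurve K) (v : HeightOneSpectrum (𝓞 K)) {d : K}

omit W in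
/-- If the chosen `ι√d ∈ K̄_v` lies outside `K_v^{nr}`, then `d` has no square root in `K_v` (a square root `s ∈ K_v` would give `ι√d = ±s ∈ K_v`).
[folklore] -/
theorem forall_sq_ne_of_closureEmb_geomSqrt_not_mem_maxUnramified
    (hα : closureEmb (K := K) (v.adicCompletion K) (geomSqrt d) ∉ maxUnramified (v.adicCompletion K)) :
    ∀ s : v.adicCompletion K, s ^ 2 ≠ algebraMap K (v.adicCompletion K) d := by
  intro s hs
  apply hα
  have h := closureEmb_geomSqrt_sq_eq_algebraMap (K := K) (d := d) v
  rw [← hs, map_pow] at h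
  rcases sq_eq_sq_iff_eq_or_eq_neg.mp h with h' | h'
  · rw [h']; exact (maxUnramified (v.adicCompletion K)).algebraMap_mem s
  · rw [h']; exact neg_mem ((maxUnramified (v.adicCompletion K)).algebraMap_mem s)

/-- **THE RAMIFIED NORM STEP (b′) in the series' currency.** `W` good at `v`, `v` of odd residue characteristic, `α = ι√d ∉ K_v^{nr}`
(`K_v(α)/K_v` ramified quadratic), `τ₀ ∈ Γ_{K_v}` flipping `α` ⟹ every point `S ∈ W(K̄_v) = localPoints W K_v` fixed by the stabiliser of
`α` (the index-`2` subgroup `Gal(K̄_v/K_v(α))`) has `S + τ₀S = P + P` with `P` fixed by `Γ_{K_v}` — «a norm from the ramified quadratic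
extension is a double», Kramer 1981 Prop. 3 (§33 through §34 on `V = W ⊗ K_v`, `K' = K_v(α)`, transported along the `Γ_{K_v}`-equivariant
`baseChangeGeomPointsEquiv`). [cite: Kramer1981, §2 Prop. 3 (p. 125)] [cite: MazurRubin2010, Lemma 2.11] -/
theorem exists_fixed_add_self_eq_norm_of_not_mem_maxUnramified (hv : W.HasGoodReductionAt v)
    (hodd : ringChar 𝓀[v.adicCompletion K] ≠ 2)
    (hα : closureEmb (K := K) (v.adicCompletion K) (geomSqrt d) ∉ maxUnramified (v.adicCompletion K))
    {τ₀ : absoluteGaloisGroup (v.adicCompletion K)}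
    (hτ₀ : (show AlgebraicClosure (v.adicCompletion K) ≃ₐ[v.adicCompletion K] AlgebraicClosure (v.adicCompletion K) from τ₀)
        (closureEmb (K := K) (v.adicCompletion K) (geomSqrt d)) = -closureEmb (K := K) (v.adicCompletion K) (geomSqrt d))
    {S : localPoints W (v.adicCompletion K)}
    (hS : ∀ g : absoluteGaloisGroup (v.adicCompletion K),
      (show AlgebraicClosure (v.adicCompletion K) ≃ₐ[v.adicCompletion K] AlgebraicClosure (v.adicCompletion K) from g)
          (closureEmb (K := K) (v.adicCompletion K) (geomSqrt d)) = closureEmb (K := K) (v.adicCompletion K) (geomSqrt d) →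
        g • S = S) :
    ∃ P ∈ MulAction.fixedPoints (absoluteGaloisGroup (v.adicCompletion K)) (localPoints W (v.adicCompletion K)),
      S + τ₀ • S = P + P := by
  haveI : CharZero (v.adicCompletion K) := charZero_of_injective_algebraMap (algebraMap K _).injective
  have hd := forall_sq_ne_of_closureEmb_geomSqrt_not_mem_maxUnramified v hα
  have h2 := finrank_adjoin_closureEmb_geomSqrt_eq_two v hd
  haveI : Algebra.IsQuadraticExtension (v.adicCompletion K)
      (IntermediateField.adjoin (v.adicCompletion K) {closureEmb (K := K) (v.adicCompletion K) (geomSqrt d)}) :=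
    { finrank_eq_two' := h2 }
  -- `σ := τ₀|_{K'}`, `σ(ι√d) = −ι√d`, `σ ≠ 1`
  set σ := (show AlgebraicClosure (v.adicCompletion K) ≃ₐ[v.adicCompletion K] AlgebraicClosure (v.adicCompletion K)
    from τ₀).restrictNormal
      (IntermediateField.adjoin (v.adicCompletion K) {closureEmb (K := K) (v.adicCompletion K) (geomSqrt d)}) with hσdef
  have hσ : ((σ (IntermediateField.AdjoinSimple.gen (v.adicCompletion K)
      (closureEmb (K := K) (v.adicCompletion K) (geomSqrt d))) :
        IntermediateField.adjoin (v.adicCompletion K) {closureEmb (K := K) (v.adicCompletion K) (geomSqrt d)}) :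
          AlgebraicClosure (v.adicCompletion K)) = -closureEmb (K := K) (v.adicCompletion K) (geomSqrt d) := by
    have h := AlgEquiv.restrictNormal_commutes
      (show AlgebraicClosure (v.adicCompletion K) ≃ₐ[v.adicCompletion K] AlgebraicClosure (v.adicCompletion K) from τ₀)
      (IntermediateField.adjoin (v.adicCompletion K) {closureEmb (K := K) (v.adicCompletion K) (geomSqrt d)})
      (IntermediateField.AdjoinSimple.gen (v.adicCompletion K) (closureEmb (K := K) (v.adicCompletion K) (geomSqrt d)))
    rw [← hσdef] at h
    change ((σ _ : IntermediateField.adjoin (v.adicCompletion K) {closureEmb (K := K) (v.adicCompletion K) (geomSqrt d)}) :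
      AlgebraicClosure (v.adicCompletion K)) = (show AlgebraicClosure (v.adicCompletion K) ≃ₐ[v.adicCompletion K]
        AlgebraicClosure (v.adicCompletion K) from τ₀) (closureEmb (K := K) (v.adicCompletion K) (geomSqrt d)) at h
    rw [h, hτ₀]
  have hα0 : closureEmb (K := K) (v.adicCompletion K) (geomSqrt d) ≠ 0 := by
    intro h0
    apply hd 0
    have h := closureEmb_geomSqrt_sq_eq_algebraMap (K := K) (d := d) v
    rw [h0, zero_pow two_ne_zero, eq_comm, map_eq_zero] at h
    rw [h, zero_pow two_ne_zero]
  have hσ1 : σ ≠ 1 := by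
    intro h1
    rw [h1, AlgEquiv.one_apply, IntermediateField.AdjoinSimple.coe_gen, eq_neg_iff_add_eq_zero, ← two_mul,
      mul_eq_zero] at hσ
    exact hσ.elim (fun h ↦ two_ne_zero h) hα0
  -- ramified, non-square, the square root
  have hram : ¬ IntermediateField.adjoin (v.adicCompletion K) {closureEmb (K := K) (v.adicCompletion K) (geomSqrt d)} ≤
      maxUnramified (v.adicCompletion K) := fun h ↦
    hα (h (IntermediateField.mem_adjoin_simple_self (v.adicCompletion K) _))
  have hdsq : ¬ IsSquare (algebraMap K (v.adicCompletion K) d) := by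
    rintro ⟨s, hs⟩
    exact hd s (by rw [sq]; exact hs.symm)
  have hx := adjoinSimple_gen_sq (K := K) (d := d) v
  -- §33 on `K'`-points, §34 descent on `V = W ⊗ K_v`, transport to `localPoints`
  have hN := fun S₁ ↦ exists_norm_eq_baseChange_add_self_of_hasGoodReductionAt W v hv hodd h2 hram hdsq hx hσ1 S₁
  have hτ₀' := forall_apply_eq_of_apply_adjoin_gen_eq_apply (d := d) (v.adicCompletion K) τ₀ σ (hτ₀.trans hσ.symm)
  set e := W.baseChangeGeomPointsEquiv (v.adicCompletion K) with he
  have hS' : ∀ g : absoluteGaloisGroup (v.adicCompletion K),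
      (∀ x : (IntermediateField.adjoin (v.adicCompletion K) {closureEmb (K := K) (v.adicCompletion K) (geomSqrt d)}),
        (show AlgebraicClosure (v.adicCompletion K) ≃ₐ[v.adicCompletion K] AlgebraicClosure (v.adicCompletion K) from g)
          (x : AlgebraicClosure (v.adicCompletion K)) = x) → g • e.symm S = e.symm S := by
    intro g hg
    rw [← W.baseChangeGeomPointsEquiv_symm_smul (v.adicCompletion K) g S, hS g ?_]
    have := hg (IntermediateField.AdjoinSimple.gen (v.adicCompletion K) (closureEmb (K := K) (v.adicCompletion K) (geomSqrt d)))
    rwa [IntermediateField.AdjoinSimple.coe_gen] at this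
  obtain ⟨P', hP'fix, hP'⟩ := exists_fixed_add_self_eq_norm_of_forall_exists (W.baseChange (v.adicCompletion K))
    (IntermediateField.adjoin (v.adicCompletion K) {closureEmb (K := K) (v.adicCompletion K) (geomSqrt d)}) σ hN hτ₀' hS'
  refine ⟨e P', fun g ↦ ?_, ?_⟩
  · rw [← W.baseChangeGeomPointsEquiv_smul (v.adicCompletion K) g P', hP'fix g]
  · rw [← map_add, ← hP', map_add, W.baseChangeGeomPointsEquiv_smul (v.adicCompletion K) τ₀, he, AddEquiv.apply_symm_apply]

end Local

/-! ## §35 Mazur–Rubin's Lemma 2.11 in prime-twist currency: `H¹_𝒜(K_v) ∩ H¹_f(K_v) = 0` at a ramified odd good place -/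

section Ramified

variable {K : Type} [Field K] [NumberField K] (W : WeierstrassCurve K) [W.IsElliptic] (v : HeightOneSpectrum (𝓞 K)) {d : K}
  (χ : absoluteGaloisGroup K →ₜ* Multiplicative (ZMod 2))

/-- **THE TWISTED AND THE UNTWISTED `2`-SELMER LOCAL CONDITIONS MEET ONLY IN `0` AT A RAMIFIED ODD GOOD PLACE** (Mazur–Rubin 2010
Lemma 2.11 / 2007 Prop. 5.2, prime-twist currency, `p = 2`). `W/K` elliptic over a number field, `v` a finite place of good reduction with odd
residue characteristic, `α = ι√d ∉ K_v^{nr}` (so `K_v(α)/K_v` is ramified quadratic), `χ : Γ_K → {±1}` with `χ(res τ) = 1 ↔ τα = α` on `Γ_{K_v}`.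
Then a class `c ∈ H¹(K, E[2])` in Mazur–Rubin's twisted condition `PrimeTwist.selmerLocalKer W χ K_v` AND in `W`'s Kummer condition
`W.selmerLocalKer K_v 2` restricts to `0` in `H¹(K_v, E[2])`: `c|_{Γ_v} = κ(Q)` with `2Q ∈ E(K_v)` (Kummer), `2Q = S + τ₀S` with `S ∈ E(K_v(α))`
(step (a′), `exists_norm_form_of_mem_primeTwist_selmerLocalKer`), `= P + P` with `P ∈ E(K_v)` (step (b′), Kramer), so `κ(Q) = κ(P) = 0`.
[cite: MazurRubin2010, Lemma 2.9 and Lemma 2.11] [cite: MazurRubin2007, Def 4.3 and Prop 5.2] [cite: Kramer1981, §2 Prop. 3 (p. 125)] -/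
theorem res_eq_zero_of_mem_primeTwist_selmerLocalKer_of_mem_selmerLocalKer_of_ramified (hv : W.HasGoodReductionAt v)
    (hodd : ringChar 𝓀[v.adicCompletion K] ≠ 2)
    (hα : closureEmb (K := K) (v.adicCompletion K) (geomSqrt d) ∉ maxUnramified (v.adicCompletion K))
    (hχα : ∀ τ : absoluteGaloisGroup (v.adicCompletion K), χ (resGal (K := K) (v.adicCompletion K) τ) = 1 ↔
      (show AlgebraicClosure (v.adicCompletion K) ≃ₐ[v.adicCompletion K] AlgebraicClosure (v.adicCompletion K) from τ)
        (closureEmb (K := K) (v.adicCompletion K) (geomSqrt d)) = closureEmb (K := K) (v.adicCompletion K) (geomSqrt d))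
    {c : W.galH1Torsion ((2 : ℕ) : ℤ)} (hc𝒜 : c ∈ PrimeTwist.selmerLocalKer W χ (v.adicCompletion K))
    (hcf : c ∈ W.selmerLocalKer (v.adicCompletion K) ((2 : ℕ) : ℤ)) :
    galoisCohomology.res (W.torsionGaloisModule ((2 : ℕ) : ℤ)) (v.adicCompletion K) 1 c = 0 := by
  haveI : Fact (Nat.Prime 2) := ⟨Nat.prime_two⟩
  haveI : CharZero (v.adicCompletion K) := charZero_of_injective_algebraMap (algebraMap K _).injective
  have h2 : ((2 : ℕ) : ℤ) ≠ 0 := by decide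
  -- Kummer reading of `c` at `K_v`: `c|_{Γ_v} = κ(Q)` with `2Q ∈ E(K_v)`
  obtain ⟨Q, hQ, hcQ⟩ := W.exists_eq_localKummerClass_of_mem ((2 : ℕ) : ℤ) h2
    (mem_kummerLocalConditionAt_res_of_mem_selmerLocalKer W _ _ hcf)
  -- step (a′): `2Q = S + τS` for every `τ` off `ker χ`, `S` fixed by `ker χ`
  obtain ⟨S, hSfix, hSnorm⟩ := exists_norm_form_of_mem_primeTwist_selmerLocalKer W χ (v.adicCompletion K) h2 hc𝒜 hQ hcQ
  -- a flip `τ₀` of `α`, necessarily off `ker χ`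
  have hd := forall_sq_ne_of_closureEmb_geomSqrt_not_mem_maxUnramified v hα
  obtain ⟨τ₀, hτ₀⟩ := exists_flip_closureEmb_geomSqrt v hd
  have hα0 : closureEmb (K := K) (v.adicCompletion K) (geomSqrt d) ≠ 0 := by
    intro h0
    apply hd 0
    have h := closureEmb_geomSqrt_sq_eq_algebraMap (K := K) (d := d) v
    rw [h0, zero_pow two_ne_zero, eq_comm, map_eq_zero] at h
    rw [h, zero_pow two_ne_zero]
  have hτ₀χ : PrimeTwist.localChar χ (v.adicCompletion K) τ₀ ≠ 1 := by
    intro h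
    have h' : χ (resGal (K := K) (v.adicCompletion K) τ₀) = 1 := h
    rw [hχα τ₀, hτ₀, neg_eq_iff_add_eq_zero, ← two_mul, mul_eq_zero] at h'
    exact h'.elim (fun h2' ↦ two_ne_zero h2') hα0
  -- step (b′): `S + τ₀S = P + P` with `P ∈ E(K_v)`
  have hS' : ∀ g : absoluteGaloisGroup (v.adicCompletion K),
      (show AlgebraicClosure (v.adicCompletion K) ≃ₐ[v.adicCompletion K] AlgebraicClosure (v.adicCompletion K) from g)
          (closureEmb (K := K) (v.adicCompletion K) (geomSqrt d)) = closureEmb (K := K) (v.adicCompletion K) (geomSqrt d) →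
        g • S = S := fun g hg ↦ hSfix g ((hχα g).mpr hg)
  obtain ⟨P, hP, hPP⟩ := exists_fixed_add_self_eq_norm_of_not_mem_maxUnramified W v hv hodd hα hτ₀ hS'
  have h2Q : ((2 : ℕ) : ℤ) • Q = ((2 : ℕ) : ℤ) • P := by
    rw [hSnorm τ₀ hτ₀χ, hPP]
    simp only [Nat.cast_ofNat, two_zsmul]
  have hP2 : ((2 : ℕ) : ℤ) • P ∈
      MulAction.fixedPoints (absoluteGaloisGroup (v.adicCompletion K)) (localPoints W (v.adicCompletion K)) := by
    rw [← h2Q]; exact hQ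
  -- `κ(Q) = κ(P) = 0`
  rw [hcQ, W.localKummerClass_eq_of_zsmul_eq ((2 : ℕ) : ℤ) h2 Q P hQ hP2 h2Q, localKummerClass_eq_zero_iff]
  exact ⟨0, zero_mem _, by rw [sub_zero]; exact hP⟩

end Ramified

/-! ## §36 Over `ℚ`: the one-place dictionary at the door primes, and T-2q BY NAME -/

section Rat

open Rat.HeightOneSpectrum (primesEquiv natGenerator)
open Summit.BirchSwinnertonDyer.Rank1Residual.F1Sign2
open Summit.BirchSwinnertonDyer.Rank1Residual.F1Sign2.TranspositionDoor (MeetsNonNormAt)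
open Summit.BirchSwinnertonDyer.Rank1Residual.F1Sign2.TwoDoor (TwoTranspAdmissible twistCondAbove TwoTranspositionTwistLawAtTwo)

/-- **THE ONE-PLACE DICTIONARY at the door primes of a two-transposition-admissible `(d, q₀, q₁)`** — the hypothesis `hdict` of
`twoTranspositionTwistLawAtTwo_of_dictionary`, PROVED: for a globally minimal `W/ℚ`, `χ` the character of `ℚ(√d)`, `q ∈ {q₀, q₁}` with place
`v`, and a class `c` of the ∞-relaxed `2`-Selmer group of `W`: `c ∈ twistCondAbove W χ q ↔ loc_v c = 0`. (`←`: a class dying at `v` dies in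
`A_χ` — `ker_localization_le_twistCondAbove`; `→`: `q` is odd, good and RAMIFIED in `ℚ(√d)` (`d` squarefree, `q ∣ d`: `transposition_place_facts`),
`χ|_{Γ_{ℚ_v}}` cuts out `ℚ_v(ι√d)` (`localChar_eq_one_iff_of_isQuadraticCharacterOf`), and §35 applies to `c ∈ H¹_𝒜(ℚ_v) ∩ H¹_f(ℚ_v)`.)
The transposition hypothesis `(Δ/q) = −1` is not used for this step. [cite: MazurRubin2010, Lemma 2.11] [cite: MazurRubin2007, Def 4.3 and Prop 5.2]
[cite: Kramer1981, §2 Prop. 3 (p. 125)] -/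
theorem mem_twistCondAbove_iff_localization_eq_zero (W : WeierstrassCurve ℚ) [W.IsElliptic] [W.IsGloballyMinimal]
    {d : ℤ} {q₀ q₁ : ℕ} [Fact q₀.Prime] [Fact q₁.Prime] {χ : absoluteGaloisGroup ℚ →ₜ* Multiplicative (ZMod 2)}
    (hadm : TwoTranspAdmissible W d q₀ q₁) (hχ : IsQuadraticCharacterOf χ d)
    {q : ℕ} {v : HeightOneSpectrum (𝓞 ℚ)} (hq : q = q₀ ∨ q = q₁) (hv : (q : 𝓞 ℚ) ∈ v.asIdeal)
    {c : W.galH1Torsion ((2 : ℕ) : ℤ)} (hc : c ∈ selmerGroupRelaxedAtInfinityAtTwo W) :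
    c ∈ twistCondAbove W χ q ↔ galoisCohomology.localization (W.torsionGaloisModule ((2 : ℕ) : ℤ)) (Sum.inr v) 1 c = 0 := by
  obtain ⟨-, hsf, hd8, hq₀, hq₁, -, hq₀d, hq₁d, hjac₀, hjac₁, hprimes, -⟩ := hadm
  have hqP : q.Prime := by rcases hq with rfl | rfl <;> assumption
  haveI : Fact q.Prime := ⟨hqP⟩
  have hqd : (q : ℤ) ∣ d := by rcases hq with rfl | rfl <;> assumption
  have hjac : jacobiSym W.Δ.num q = -1 := by rcases hq with rfl | rfl <;> assumption
  have hgood : W.HasGoodReductionAtPrime q := (hprimes q hqP hqd).1 inferInstance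
  obtain ⟨-, -, h2v, hvW, hα, -⟩ := transposition_place_facts W hsf hd8 hqd hgood hjac hv
  refine ⟨fun hc𝒜 ↦ ?_, fun h0 ↦ ker_localization_le_twistCondAbove W χ hqP hv h0⟩
  have hc𝒜' : c ∈ PrimeTwist.selmerLocalKer W χ (v.adicCompletion ℚ) :=
    AddSubgroup.mem_iInf.mp (AddSubgroup.mem_iInf.mp hc𝒜 v) hv
  have hcf : c ∈ W.selmerLocalKer (v.adicCompletion ℚ) ((2 : ℕ) : ℤ) := (mem_selmerGroupRelaxedAtInfinityAtTwo_iff W c).mp hc v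
  have hodd : ringChar 𝓀[v.adicCompletion ℚ] ≠ 2 := v.ringChar_residueField_adicCompletion_ne (by exact_mod_cast h2v)
  exact res_eq_zero_of_mem_primeTwist_selmerLocalKer_of_mem_selmerLocalKer_of_ramified W v χ hvW hodd hα
    (localChar_eq_one_iff_of_isQuadraticCharacterOf hχ) hc𝒜' hcf

/-- **T-2q — `F1Sign2.TwoDoor.TwoTranspositionTwistLawAtTwo` HOLDS** (cell `bsd-f1-sign2`, lens `-an`, row T-2q; Mazur–Rubin 2010 §3 at
`T = {∞, q₀, q₁}` + Poonen–Rains + Kramer). For a globally minimal `W/ℚ` with `Δ > 0`, `E(ℚ)[2] = 0`, rank `1`, `Ш[2] = 0`, `E(ℚ) ⊂ E⁰(ℝ)`, every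
two-transposition-admissible `(d, q₀, q₁)` and the character `χ` of `ℚ(√d)`: (a) if a door is open at `q₀` or `q₁`, `#Sel₂(W^{(d)}) ∈ {1, 4}` and
`Sel₂(W^{(d)}) = 0 ↔ Sel^{rel ∞}_2(W) ⊓ twistCondAbove q₀ ⊓ twistCondAbove q₁ = ⊥`; (b) both doors shut: `#Sel₂(W^{(d)}) ∈ {4, 16}`. Assembly:
`twoTranspositionTwistLawAtTwo_of_dictionary` (counting half p662416, quadratic `iff` p669774, reduction to the dictionary p671809) with the
dictionary `mem_twistCondAbove_iff_localization_eq_zero` (this file: step (a′) p672791 + Kramer's ramified norm step). Known in print; kernel-new;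
BSD is not proved by this. [cite: MazurRubin2010, Lemma 3.2 and Lemma 2.11] [cite: PoonenRains2012, Thm. 4.14] [cite: KlagsbrunMazurRubin2014, Prop. 47 (ii)]
[cite: Kramer1981, §2 Prop. 3 (p. 125)] -/
theorem twoTranspositionTwistLawAtTwo_holds : TwoTranspositionTwistLawAtTwo :=
  twoTranspositionTwistLawAtTwo_of_dictionary fun W _ _ _ _ _ _ _ _ hadm hχ _ _ hq hv _ hc ↦
    mem_twistCondAbove_iff_localization_eq_zero W hadm hχ hq hv hc

end Rat

end Summit.BirchSwinnertonDyer.BirchSwinnertonDyer.Theorems.GenusKolyTransp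

end
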